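import Literature.NumberTheory.DiophantineGeometry.BelyiDegreeFaltingsHeightProofs
import Literature.NumberTheory.DiophantineGeometry.BelyiTransport
import Literature.NumberTheory.DiophantineGeometry.FunctionFieldDivisorsAdicProofs
import Mathlib.FieldTheory.RatFunc.IntermediateField
import HarnessLib

/-!
# Belyi degree `≤ 2` forces the projective line; `deg_B(ℙ¹) = 1`

Topic `NumberTheory/DiophantineGeometry`; in the orbit of the named fact
`javanpeykar2014_stableFaltingsHeight_le` of `BelyiDegreeFaltingsHeight.lean` (Belyi degrees of
function fields). Zapponi, [cite: Zapponi2009BelyiDegree, Example 1.2]: "The projective line is the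
unique curve of Belyi degree less than or equal to `2`." In function-field terms, over an
algebraically closed constant field `K` of characteristic `0`:

* `isBelyiFunction_ratFunc_X`, **`belyiDegree_ratFunc`**: `deg_B(K(X)/K) = 1` (the coordinate `X`
  is a Belyi function of degree `1`);
* **`exists_finrank_adjoin_eq_one_of_genus_eq_zero`** (Stichtenoth Prop. 1.6.3): a function field of
  genus `0` with a rational place `P` is rational — Riemann's inequality gives `ℓ(P) ≥ 2`, a
  non-constant `x ∈ L(P)` has the single simple pole `P`, so `[F : K(x)] = deg (x)_∞ = 1`; hence
  `nonempty_algEquiv_ratFunc_of_genus_eq_zero` (`F ≃ₐ[K] K(X)`);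
* **`belyiDegree_eq_one_of_le_two`**, `nonempty_algEquiv_ratFunc_of_belyiDegree_le_two`: if
  `deg_B(F/K) ≤ 2` (and `F` has a Belyi function at all) then `g = 0` (`2g + 1 ≤ deg_B`,
  `IsBelyiFunction.two_mul_genus_add_one_le_finrank_of_isAlgClosed`), `F ≅ K(X)` and in fact
  `deg_B(F/K) = 1`: **no curve has Belyi degree `2`**.

## References

* L. Zapponi, *On the Belyi degree(s) of a curve defined over a number field*, arXiv:0904.0967
  (2009), Example 1.2. [Zapponi2009BelyiDegree]
* H. Stichtenoth, *Algebraic Function Fields and Codes*, 2nd ed., GTM 254, Springer 2009,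
  Prop. 1.6.3, Thm. 1.4.17(a), Thm. 1.4.11. [Stichtenoth2009]
-/

noncomputable section

namespace Literature.NumberTheory.DiophantineGeometry.AlgFunctionField

open scoped IntermediateField
open Polynomial

universe u v

variable {K : Type u} {F : Type v} [Field K] [Field F] [Algebra K F]

/-! ### Genus zero with a rational place: `F = K(x)` (Stichtenoth Prop. 1.6.3) -/

/-- **Stichtenoth Prop. 1.6.3: a function field of genus `0` with a rational place is rational.**
Precisely: there is `x ∈ F`, transcendental over `K`, with `[F : K(x)] = 1`, regular away from the
given rational place `P` and with a simple pole at `P` (Riemann's inequality `ℓ(P) ≥ deg P + 1 - g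
= 2` produces a non-constant `x ∈ L(P)`; its pole divisor is `P`, of degree `1 = [F : K(x)]`).
[cite: Stichtenoth2009, Prop. 1.6.3] -/
theorem exists_finrank_adjoin_eq_one_of_genus_eq_zero [IsAlgFunctionField K F]
    [IsIntegrallyClosedIn K F] (hg : genus K F = 0) {P : PlaceOver K F} (hP : P.IsRational) :
    ∃ x : F, Transcendental K x ∧ Module.finrank K⟮x⟯ F = 1 ∧
      (∀ v : PlaceOver K F, v ≠ P → 0 ≤ v.ord x) ∧ P.ord x = -1 := by
  classical
  set D : Divisor K F := Finsupp.single P 1 with hD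
  have hdeg : D.degree = 1 := by
    rw [hD, Divisor.degree_single, hP]; norm_num
  -- Riemann: `ℓ(P) ≥ 2`
  have hell : (2 : ℤ) ≤ ell D := by
    have h := degree_add_one_sub_genus_le_ell (K := K) D
    rw [hdeg, hg] at h
    simpa using h
  -- a non-constant element of `L(P)`
  have hex : ∃ x ∈ riemannRochSpace D, x ∉ Set.range (algebraMap K F) := by
    by_contra hne
    push Not at hne
    have hle : riemannRochSpace D ≤ Subalgebra.toSubmodule (⊥ : Subalgebra K F) := fun x hx ↦ by
      rw [Subalgebra.mem_toSubmodule, Algebra.mem_bot]; exact hne x hx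
    have hbot : Module.finrank K (Subalgebra.toSubmodule (⊥ : Subalgebra K F)) = 1 := by
      rw [Subalgebra.finrank_toSubmodule, Subalgebra.finrank_bot]
    haveI : Module.Finite K (Subalgebra.toSubmodule (⊥ : Subalgebra K F)) :=
      Module.finite_of_finrank_eq_succ hbot
    have h1 : Module.finrank K (riemannRochSpace D) ≤ 1 := by
      have := Submodule.finrank_mono hle
      rwa [hbot] at this
    have : (ell D : ℤ) ≤ 1 := by unfold ell; exact_mod_cast h1
    omega
  obtain ⟨x, hxD, hxK⟩ := hex
  have hx0 : x ≠ 0 := fun h ↦ hxK ⟨0, by rw [map_zero, h]⟩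
  have hxt : Transcendental K x := transcendental_of_not_mem_range hxK
  have hord : ∀ v : PlaceOver K F, -D v ≤ v.ord x :=
    (mem_riemannRochSpace_iff_neg_le_ord D hx0).1 hxD
  have hreg : ∀ v : PlaceOver K F, v ≠ P → 0 ≤ v.ord x := fun v hv ↦ by
    have h := hord v
    rwa [hD, Finsupp.single_eq_of_ne hv, neg_zero] at h
  have hP1 : -1 ≤ P.ord x := by
    have h := hord P
    rwa [hD, Finsupp.single_eq_same] at h
  -- `x` has a pole (it is not constant), necessarily at `P`, simple
  have hPneg : P.ord x = -1 := by
    rcases (show P.ord x = -1 ∨ 0 ≤ P.ord x by omega) with h | h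
    · exact h
    · exfalso
      have hx0D : x ∈ riemannRochSpace (0 : Divisor K F) := by
        rw [mem_riemannRochSpace_iff_neg_le_ord 0 hx0]
        intro v
        rw [Finsupp.coe_zero, Pi.zero_apply, neg_zero]
        by_cases hv : v = P
        · rw [hv]; exact h
        · exact hreg v hv
      rw [riemannRochSpace_zero_eq_bot, Subalgebra.mem_toSubmodule, Algebra.mem_bot] at hx0D
      exact hxK hx0D
  refine ⟨x, hxt, ?_, hreg, hPneg⟩
  -- `[F : K(x)] = deg (x)_∞ = deg P = 1`
  have hneg : (principalDivisor K x)⁻ = D := by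
    ext v
    rw [Divisor.negPart_apply, principalDivisor_apply_of_ne_zero hx0, hD]
    by_cases hv : v = P
    · rw [hv, Finsupp.single_eq_same, hPneg]; norm_num
    · rw [Finsupp.single_eq_of_ne hv]
      have := hreg v hv
      exact max_eq_right (by omega)
  have h := degree_negPart_principalDivisor_eq hxt
  rw [hneg, hdeg] at h
  exact_mod_cast h.symm

/-- **A genus-`0` function field with a rational place is `K`-isomorphic to the rational function
field `K(X)`.** [cite: Stichtenoth2009, Prop. 1.6.3] -/
theorem nonempty_algEquiv_ratFunc_of_genus_eq_zero [IsAlgFunctionField K F]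
    [IsIntegrallyClosedIn K F] (hg : genus K F = 0) {P : PlaceOver K F} (hP : P.IsRational) :
    Nonempty (F ≃ₐ[K] RatFunc K) := by
  obtain ⟨x, hxt, h1, -, -⟩ := exists_finrank_adjoin_eq_one_of_genus_eq_zero hg hP
  have htop : K⟮x⟯ = ⊤ := IntermediateField.finrank_eq_one_iff_eq_top.mp h1
  exact ⟨((ratFuncAlgEquivAdjoin hxt).trans
    ((IntermediateField.equivOfEq htop).trans IntermediateField.topEquiv)).symm⟩

/-! ### The rational function field: `deg_B(K(X)) = 1` -/

/-- `X ∉ K`. [folklore] -/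
theorem ratFunc_X_not_mem_range :
    (RatFunc.X : RatFunc K) ∉ Set.range (algebraMap K (RatFunc K)) := by
  rintro ⟨c, hc⟩
  have h := congr_arg RatFunc.num hc
  rw [RatFunc.algebraMap_eq_C, RatFunc.num_C, RatFunc.num_X] at h
  exact Polynomial.X_ne_C c h.symm

/-- `[K(X) : K(X)] = 1`: the coordinate `X` generates the rational function field. [folklore] -/
theorem finrank_adjoin_ratFunc_X : Module.finrank K⟮(RatFunc.X : RatFunc K)⟯ (RatFunc K) = 1 := by
  rw [RatFunc.adjoin_X]
  exact IntermediateField.finrank_top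

/-- **The coordinate `X` is a Belyi function of `K(X)/K`** (`K` algebraically closed of
characteristic `0`): every fibre `X = c` is a single simple zero, `Σ_P v_P(X - c) = [K(X) : K(X)]
= 1`. [cite: Zapponi2009BelyiDegree, Example 1.2] -/
theorem isBelyiFunction_ratFunc_X [IsAlgClosed K] [CharZero K] :
    IsBelyiFunction K (RatFunc.X : RatFunc K) := by
  classical
  haveI := isIntegrallyClosedIn_of_isAlgClosed (K := K) (F := RatFunc K)
  have hrat : ∀ P : PlaceOver K (RatFunc K), P.IsRational := PlaceOver.isRational_of_isAlgClosed
  refine ⟨ratFunc_X_not_mem_range, fun c _ _ P hP ↦ ?_⟩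
  have hne : (RatFunc.X : RatFunc K) - algebraMap K (RatFunc K) c ≠ 0 := fun h ↦
    ratFunc_X_not_mem_range ⟨c, (sub_eq_zero.1 h).symm⟩
  set U : Finset (PlaceOver K (RatFunc K)) :=
    (finite_setOf_ord_ne_zero_holds (K := K) hne).toFinset.filter
      fun Q ↦ 0 < Q.ord ((RatFunc.X : RatFunc K) - algebraMap K (RatFunc K) c) with hU
  have hmem : ∀ Q, Q ∈ U ↔ 0 < Q.ord ((RatFunc.X : RatFunc K) - algebraMap K (RatFunc K) c) :=
    fun Q ↦ by
      rw [hU, Finset.mem_filter, Set.Finite.mem_toFinset, Set.mem_setOf_eq]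
      exact ⟨fun h ↦ h.2, fun h ↦ ⟨h.ne', h⟩⟩
  have hsum := sum_ord_sub_eq_finrank hrat ratFunc_X_not_mem_range c U (fun Q hQ ↦ (hmem Q).1 hQ)
    fun Q hQ ↦ (hmem Q).2 hQ
  rw [finrank_adjoin_ratFunc_X, Nat.cast_one] at hsum
  have hPU : P ∈ U := (hmem P).2 hP
  have hle : P.ord ((RatFunc.X : RatFunc K) - algebraMap K (RatFunc K) c) ≤ 1 := by
    rw [← hsum, ← Finset.sum_erase_add U _ hPU]
    have : 0 ≤ ∑ Q ∈ U.erase P, Q.ord ((RatFunc.X : RatFunc K) - algebraMap K (RatFunc K) c) :=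
      Finset.sum_nonneg fun Q hQ ↦ ((hmem Q).1 (Finset.mem_of_mem_erase hQ)).le
    omega
  omega

/-- **`deg_B(K(X)/K) = 1`**: the Belyi degree of the rational function field (the projective
line) is `1`. [cite: Zapponi2009BelyiDegree, Example 1.2] -/
theorem belyiDegree_ratFunc [IsAlgClosed K] [CharZero K] : belyiDegree K (RatFunc K) = 1 := by
  haveI := isIntegrallyClosedIn_of_isAlgClosed (K := K) (F := RatFunc K)
  refine le_antisymm ?_ (belyiDegree_pos ⟨_, isBelyiFunction_ratFunc_X⟩)
  have h := belyiDegree_le_finrank (isBelyiFunction_ratFunc_X (K := K))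
  rwa [finrank_adjoin_ratFunc_X] at h

/-! ### Belyi degree `≤ 2` forces the projective line -/

section AlgClosed

variable [IsAlgFunctionField K F] [IsAlgClosed K] [CharZero K]

/-- **A curve of Belyi degree `≤ 2` has genus `0`** (`2g + 1 ≤ deg_B`).
[cite: Zapponi2009BelyiDegree, Example 1.2] -/
theorem genus_eq_zero_of_belyiDegree_le_two (hex : ∃ f : F, IsBelyiFunction K f)
    (h2 : belyiDegree K F ≤ 2) : genus K F = 0 := by
  obtain ⟨f, hf, hfd⟩ := exists_finrank_eq_belyiDegree hex
  have h := hf.two_mul_genus_add_one_le_finrank_of_isAlgClosed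
  rw [hfd] at h
  omega

/-- **A curve of Belyi degree `≤ 2` is the projective line**: its function field is
`K`-isomorphic to `K(X)`. [cite: Zapponi2009BelyiDegree, Example 1.2] -/
theorem nonempty_algEquiv_ratFunc_of_belyiDegree_le_two (hex : ∃ f : F, IsBelyiFunction K f)
    (h2 : belyiDegree K F ≤ 2) : Nonempty (F ≃ₐ[K] RatFunc K) := by
  haveI := isIntegrallyClosedIn_of_isAlgClosed (K := K) (F := F)
  obtain ⟨P⟩ : Nonempty (PlaceOver K F) := nonempty_placeOver
  exact nonempty_algEquiv_ratFunc_of_genus_eq_zero (genus_eq_zero_of_belyiDegree_le_two hex h2)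
    (PlaceOver.isRational_of_isAlgClosed P)

/-- **No curve has Belyi degree `2`**: `deg_B(F/K) ≤ 2` forces `deg_B(F/K) = 1` (the curve is
`ℙ¹`, of Belyi degree `1`; `belyiDegree_eq_of_algEquiv`). "The projective line is the unique curve
of Belyi degree less than or equal to `2`." [cite: Zapponi2009BelyiDegree, Example 1.2] -/
theorem belyiDegree_eq_one_of_le_two (hex : ∃ f : F, IsBelyiFunction K f)
    (h2 : belyiDegree K F ≤ 2) : belyiDegree K F = 1 := by
  obtain ⟨e⟩ := nonempty_algEquiv_ratFunc_of_belyiDegree_le_two hex h2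
  rw [belyiDegree_eq_of_algEquiv e, belyiDegree_ratFunc]

/-- Equivalently: **`deg_B(F/K) ≠ 2`** for every function field carrying a Belyi function.
[cite: Zapponi2009BelyiDegree, Example 1.2] -/
theorem belyiDegree_ne_two : belyiDegree K F ≠ 2 := by
  intro h2
  by_cases hex : ∃ f : F, IsBelyiFunction K f
  · have := belyiDegree_eq_one_of_le_two hex h2.le
    omega
  · push Not at hex
    rw [belyiDegree_eq_zero_of_forall_not hex] at h2
    exact absurd h2 (by norm_num)

end AlgClosed

end Literature.NumberTheory.DiophantineGeometry.AlgFunctionField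

end
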